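import Mathlib
import Summits.Ventures.PercRepro2.Defs
import Summits.Ventures.PercRepro2.Independence
import Summits.Ventures.PercRepro2.Graph
import Summits.Ventures.PercRepro2.DisagreementSum
import Summits.Ventures.PercRepro2.DisagreementPinned

/-!
# The two-copy cross-cluster BHK inequality from its weight-free base case
(blind cell PercRepro2, p1; `proofs/P1-TWOCOPY.md` §2–3)

With `Q = {l ↮ h}`, `oL = {o ∈ C_l}`, `bH = {b ∈ C_h}` the **cross-cluster BHK kernel** is

  `K(x, y) = 1_Q(x) 1_Q(y) (1_{oL}(x) − 1_{oL}(y)) (1_{bH}(y) − 1_{bH}(x))`.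

* `biForm_crossKernel`: `∑_{x,y} P_q(x) P_{q'}(y) K(x,y)
  = P_q(Q,oL) P_{q'}(Q,bH) + P_q(Q,bH) P_{q'}(Q,oL) − P_q(Q,oL,bH) P_{q'}(Q) − P_q(Q) P_{q'}(Q,oL,bH)`;
  for `q = q'` this is twice the BHK06 Thm 1.4 slack `P(Q,oL)P(Q,bH) − P(Q)P(Q,oL,bH)`.
* `CrossBase R ends l h o b`: every *pinned* disagreement sum of `K` is nonnegative (the weights off
  the disagreement set are `0` or `1`) — a weight-free counting statement about 2-colourings of the
  minors ("given `l ↮ h` in both colours, the connections `o–l` and `b–h` prefer different colours";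
  exact census 0 negatives on 2.5M markings, n ≤ 8, `proofs/P1-TWOCOPY.md` §3).
* `twoCopyBHK_of_crossBase`: under `CrossBase`, for every edge `f` and weights `p`, the
  **two-copy (line-convexity) form** `P¹(Q,oL)P⁰(Q,bH) + P¹(Q,bH)P⁰(Q,oL) ≥ P¹(Q,oL,bH)P⁰(Q) + P¹(Q)P⁰(Q,oL,bH)`
  holds, `P⁰ / P¹` = `p` with `f` pinned closed / open — mine-1's conjecture (MINE-1.md §19.7), the
  mixed coefficient of the BHK slack along every edge line.
* `bhk_cross_of_crossBase`: under `CrossBase` the one-copy inequality itself follows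
  (`disSum p ∅ = biForm p p`), a second, elementary proof route for BHK06 Thm 1.4.
* `CrossCount R ends l h o b`: the literal 2-colouring statement — for every minor `(G, z)` the
  complementary-pair count `pinnedCount G z K ≥ 0`; `crossBase_of_crossCount` turns it into
  `CrossBase` (`disSum_pinned_eq`), so the census-checked statement is exactly the hypothesis.
-/

namespace Summit.Ventures.PercRepro2

section CrossKernel

variable {V : Type*} {E : Type*} [Fintype E] [DecidableEq E] {R : Type*} [CommRing R]

/-- The cross-cluster BHK kernel
`K(x,y) = 1_Q(x) 1_Q(y) (1_{oL}(x) − 1_{oL}(y)) (1_{bH}(y) − 1_{bH}(x))` with `Q = {l ↮ h}`,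
`oL = {l ↔ o}`, `bH = {h ↔ b}`. -/
noncomputable def crossKernel (ends : E → Sym2 V) (l h o b : V) (x y : Config E) : R :=
  ((connEvent ends l h)ᶜ).indicator 1 x * ((connEvent ends l h)ᶜ).indicator 1 y *
    ((connEvent ends l o).indicator 1 x - (connEvent ends l o).indicator 1 y) *
    ((connEvent ends h b).indicator 1 y - (connEvent ends h b).indicator 1 x)

/-- The bilinear form of the cross kernel between two weight vectors, in probabilities. -/
theorem biForm_crossKernel (q q' : E → R) (ends : E → Sym2 V) (l h o b : V) :
    biForm q q' (crossKernel ends l h o b) =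
      prob q ((connEvent ends l h)ᶜ ∩ connEvent ends l o) *
          prob q' ((connEvent ends l h)ᶜ ∩ connEvent ends h b) +
        prob q ((connEvent ends l h)ᶜ ∩ connEvent ends h b) *
          prob q' ((connEvent ends l h)ᶜ ∩ connEvent ends l o) -
        prob q ((connEvent ends l h)ᶜ ∩ connEvent ends l o ∩ connEvent ends h b) *
          prob q' (connEvent ends l h)ᶜ -
        prob q (connEvent ends l h)ᶜ *
          prob q' ((connEvent ends l h)ᶜ ∩ connEvent ends l o ∩ connEvent ends h b) := by
  simp only [prob_eq_expect_indicator, expect, biForm, Finset.sum_mul_sum]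
  rw [← Finset.sum_add_distrib, ← Finset.sum_sub_distrib, ← Finset.sum_sub_distrib]
  refine Finset.sum_congr rfl fun x _ => ?_
  rw [← Finset.sum_add_distrib, ← Finset.sum_sub_distrib, ← Finset.sum_sub_distrib]
  refine Finset.sum_congr rfl fun y _ => ?_
  simp only [crossKernel, indicator_inter_one]
  ring

/-- The bilinear form of the cross kernel is symmetric in the two weight vectors. -/
lemma biForm_crossKernel_comm (q q' : E → R) (ends : E → Sym2 V) (l h o b : V) :
    biForm q q' (crossKernel ends l h o b) = biForm q' q (crossKernel ends l h o b) := by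
  rw [biForm_crossKernel, biForm_crossKernel]
  ring

end CrossKernel

section CrossBase

variable {V : Type*} {E : Type*} [Fintype E] [DecidableEq E]

/-- **The weight-free base hypothesis** for the cross kernel: every pinned disagreement sum is
nonnegative (weights off the disagreement set `G` equal to `0` or `1`). Each such sum is
`∏_{e ∈ G} q_e (1 − q_e)` times a count over complementary pairs of configurations on `G`
(2-colourings of the corresponding minor), so this is a purely combinatorial statement
(`proofs/P1-TWOCOPY.md` §3; conjectured, census-clean). -/
def CrossBase (R : Type*) [CommRing R] [LinearOrder R] (ends : E → Sym2 V) (l h o b : V) :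
    Prop :=
  ∀ (q : E → R) (G : Finset E), (∀ e, 0 ≤ q e ∧ q e ≤ 1) →
    (∀ e, e ∉ G → q e = 0 ∨ q e = 1) → 0 ≤ disSum q G (crossKernel ends l h o b)

/-- **The weight-free 2-colouring statement (BASE)**: for every minor `(G, z)` the
complementary-pair count of the cross kernel is nonnegative,
`∑_{x : x = z off G} K(x, flipOn G x) ≥ 0` — "given `l ↮ h` in both colours, the connections `o–l`
and `b–h` prefer different colours" (`proofs/P1-TWOCOPY.md` §3). -/
def CrossCount (R : Type*) [CommRing R] [LinearOrder R] (ends : E → Sym2 V) (l h o b : V) :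
    Prop :=
  ∀ (G : Finset E) (z : Config E), 0 ≤ pinnedCount G z (crossKernel (R := R) ends l h o b)

variable {R : Type*} [CommRing R] [LinearOrder R] [IsStrictOrderedRing R]

/-- The 2-colouring statement gives the pinned base hypothesis. -/
theorem crossBase_of_crossCount {ends : E → Sym2 V} {l h o b : V}
    (hC : CrossCount R ends l h o b) : CrossBase R ends l h o b := by
  intro q G hq hpin
  rw [disSum_pinned_eq q G hpin]
  exact mul_nonneg (prod_weight_factors_nonneg q hq G) (hC G (pinnedConfig q))

/-- Under `CrossBase`, every disagreement sum of the cross kernel is nonnegative. -/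
theorem disSum_crossKernel_nonneg {ends : E → Sym2 V} {l h o b : V}
    (hB : CrossBase R ends l h o b) (p : E → R) (hp : ∀ e, 0 ≤ p e ∧ p e ≤ 1) (F : Finset E) :
    0 ≤ disSum p F (crossKernel ends l h o b) :=
  disSum_nonneg_of_pinned _ hB p hp F

/-- **The two-copy cross-cluster BHK inequality** (mine-1's line-convexity conjecture for the BHK
slack) under `CrossBase`: for an edge `f` with `0 < p f < 1` and `P¹ / P⁰` the laws with `f`
pinned open / closed,
`P¹(Q,oL,bH) P⁰(Q) + P¹(Q) P⁰(Q,oL,bH) ≤ P¹(Q,oL) P⁰(Q,bH) + P¹(Q,bH) P⁰(Q,oL)`. -/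
theorem twoCopyBHK_of_crossBase {ends : E → Sym2 V} {l h o b : V}
    (hB : CrossBase R ends l h o b) (p : E → R) (hp : ∀ e, 0 ≤ p e ∧ p e ≤ 1) (f : E)
    (hf0 : 0 < p f) (hf1 : p f < 1) :
    prob (Function.update p f 1) ((connEvent ends l h)ᶜ ∩ connEvent ends l o ∩ connEvent ends h b) *
          prob (Function.update p f 0) (connEvent ends l h)ᶜ +
        prob (Function.update p f 1) (connEvent ends l h)ᶜ *
          prob (Function.update p f 0)
            ((connEvent ends l h)ᶜ ∩ connEvent ends l o ∩ connEvent ends h b) ≤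
      prob (Function.update p f 1) ((connEvent ends l h)ᶜ ∩ connEvent ends l o) *
          prob (Function.update p f 0) ((connEvent ends l h)ᶜ ∩ connEvent ends h b) +
        prob (Function.update p f 1) ((connEvent ends l h)ᶜ ∩ connEvent ends h b) *
          prob (Function.update p f 0) ((connEvent ends l h)ᶜ ∩ connEvent ends l o) := by
  have hd := disSum_crossKernel_nonneg hB p hp {f}
  rw [disSum_singleton, biForm_crossKernel_comm (Function.update p f 0), ← two_mul,
    biForm_crossKernel] at hd
  have hpos : 0 < p f * (1 - p f) * 2 := by
    have : 0 < 1 - p f := sub_pos.mpr hf1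
    positivity
  have h' : 0 ≤ p f * (1 - p f) * 2 * (prob (Function.update p f 1) ((connEvent ends l h)ᶜ ∩ connEvent ends l o) *
          prob (Function.update p f 0) ((connEvent ends l h)ᶜ ∩ connEvent ends h b) +
        prob (Function.update p f 1) ((connEvent ends l h)ᶜ ∩ connEvent ends h b) *
          prob (Function.update p f 0) ((connEvent ends l h)ᶜ ∩ connEvent ends l o) -
        prob (Function.update p f 1) ((connEvent ends l h)ᶜ ∩ connEvent ends l o ∩ connEvent ends h b) *
          prob (Function.update p f 0) (connEvent ends l h)ᶜ -
        prob (Function.update p f 1) (connEvent ends l h)ᶜ *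
          prob (Function.update p f 0)
            ((connEvent ends l h)ᶜ ∩ connEvent ends l o ∩ connEvent ends h b)) := by
    linarith [hd]
  have h'' := nonneg_of_mul_nonneg_right h' hpos
  linarith [h'']

/-- Under `CrossBase` the one-copy cross-cluster BHK inequality (BHK06 Thm 1.4) follows:
`P(Q) P(Q,oL,bH) ≤ P(Q,oL) P(Q,bH)` — the `F = ∅` disagreement sum. -/
theorem bhk_cross_of_crossBase {ends : E → Sym2 V} {l h o b : V}
    (hB : CrossBase R ends l h o b) (p : E → R) (hp : ∀ e, 0 ≤ p e ∧ p e ≤ 1) :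
    prob p (connEvent ends l h)ᶜ *
        prob p ((connEvent ends l h)ᶜ ∩ connEvent ends l o ∩ connEvent ends h b) ≤
      prob p ((connEvent ends l h)ᶜ ∩ connEvent ends l o) *
        prob p ((connEvent ends l h)ᶜ ∩ connEvent ends h b) := by
  have hd := disSum_crossKernel_nonneg hB p hp ∅
  rw [disSum_empty, biForm_crossKernel] at hd
  linarith [hd]

end CrossBase

end Summit.Ventures.PercRepro2
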